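import Summits.CriticalPhenomena.PercolationContinuityZ3.Theorems.Transplant.KNLevelsTargetChain
import Literature.Probability.Percolation.KozmaNitzanHittable
import HarnessLib

/-!
# Corridor, generic part 2 — Kozma–Nitzan's Lemma 12 OVER LEVELS: chains of target steps under GROWING RESTRICTION REGIONS and the corridor
# lemma from an instance-supplied CORRIDOR PLAN (generalises `CData.corridorLemma_of_target` of `L/KozmaNitzanCorridor.lean`, ll. 1573–1640)

builds on p205010 (kernel theorem, internal audit signed; external expert review pending) — nothing in this file uses p205010.
Lane `prim-bschramm`, seat `prim-bschramm-stmt` ("Corridor generic over levels", lead 08:19Z; shape agreed with p2-g2 08:28Z/08:57Z/10:12Z: an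
ARBITRARY finitely supported weighting, subbox / kit hypotheses on the corridor regions only, conclusion `openConnIn U`).

KN's proof of Lemma 12 (pp. 23–25) is a CHAIN of applications of Lemma 10: `d` halvings inside the region `A` (support minus the far part of `D`),
then the corridor step inside `U = A ∪ corridor ⊇ A`; "inside a region `U`" is implemented, as in the original, by running Lemma 10 under the
RESTRICTED weighting `restrW U W` (`prodBernoulli_restrW_real_biUnion_openConn`: `P_{W|U}(o ↔ T) = P_W(o ↔ T inside U)`).  Over levels the
geometry of each application is a `TStep` with kits (`KNLevelsTargetChain.lean`); here:

* `TargetProperty.chainW` — chains with PER-STEP weightings and abstract links `P_{W_i}(o_i ↔ T_i) ≤ P_{W_{i+1}}(o_{i+1} ↔ B_{i+1})` (one `δ(ε, n)`);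
* `real_restrW_reachB`, `real_restrW_target` — the restricted-weighting dictionary for a step;
* `CorridorPlan G n` (regions `U_0 ⊆ U_1 ⊆ ⋯ ⊆ U_n`, steps `s_0, …, s_n`) and `CorridorPlan.Runs W p Δ δ o A Ufin B₀ Mnext` (common source `o ∈ U_i`,
  `A ⊆ U_0`, `U_n ⊆ Ufin`, `B₀ ⊆ X_0(0)`, `T_i ⊆ X_{i+1}(0)`, `T_n ⊆ Mnext`, kits at accuracy `δ` under `restrW U_i W`);
* **`corridor_of_plan`** — `TargetProperty G Δ p ⟹ ∀ ε n, ∃ δ ∈ (0,1], ∀ W, ∀ plan that runs at δ: 1 - δ < P_W(o ↔ B₀ inside A) ⟹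
  1 - ε < P_W(o ↔ Mnext inside Ufin)`.  With `B₀ = M^α_v`, `A = E_i ∪ E^α_{w,v}`-side region, `Ufin = Vx ∪ Ewv ∪ Hfull^β_{v,x}`,
  `Mnext = M^β_x` this is the `hreach` input of p2-g2's `samePWitnessAt_of_cellKit₂` (lag-1 anchors, F8-DESIGN §7); the PLAN (which boxes, the
  halvings over the macro coordinates, the corridor steps, their levels and kits) is the instance's (`ℤ^d`: KN's `halvingChain` + `corridorStep`
  data with `zdSeedKit`; `X □ ℤ²`: prisms with p3-g2's kits).
[cite: KozmaNitzan2024, §4 Lemma 12 (pp. 23–25); Lemma 11 (p. 22)]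
-/

noncomputable section

open MeasureTheory ProbabilityTheory

namespace Summit.CriticalPhenomena.PercolationContinuityZ3.Theorems

namespace Transplant

namespace KNLevels

open Literature.Probability.Percolation Literature.Probability.Percolation.KozmaNitzan Literature.Probability.LatticeModels SimpleGraph

variable {V : Type*} [DecidableEq V] {G : SimpleGraph V} [G.LocallyFinite]

/-! ## Chains with per-step weightings -/

/-- **Chains of target steps with per-step weightings**: for every `ε > 0` and `n` there is one accuracy `δ ∈ (0, 1]` such that for all
weightings `W_0, …, W_n` and steps `s_0, …, s_n` with kits at accuracy `δ` (step `i` under `W_i`), linked by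
`P_{W_i}(o_i ↔ T_i) ≤ P_{W_{i+1}}(o_{i+1} ↔ X_{i+1}(0))`, `1 - δ < P_{W_0}(o_0 ↔ X_0(0))` implies `1 - ε < P_{W_n}(o_n ↔ T_n)`.
[cite: KozmaNitzan2024, §4 Lemma 11 (p. 22), Lemma 12 (p. 24)] -/
theorem TargetProperty.chainW {Δ : ℕ} {p : unitInterval} (hT : TargetProperty G Δ p) (n : ℕ) {ε : ℝ} (hε : 0 < ε) :
    ∃ δ : ℝ, 0 < δ ∧ δ ≤ 1 ∧ ∀ (Wt : Fin (n + 1) → Sym2 V → unitInterval) (s : Fin (n + 1) → TStep G),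
      (∀ i : Fin n, (prodBernoulli (Wt (Fin.castSucc i))).real
          (⋃ t ∈ (s (Fin.castSucc i)).T, openConn (s (Fin.castSucc i)).L.o t) ≤
        (prodBernoulli (Wt i.succ)).real (s i.succ).L.reachB) →
      (∀ i : Fin (n + 1), (s i).KitsAt (Wt i) p Δ δ) →
      1 - δ < (prodBernoulli (Wt 0)).real (s 0).L.reachB →
        1 - ε < (prodBernoulli (Wt (Fin.last n))).real (⋃ t ∈ (s (Fin.last n)).T, openConn (s (Fin.last n)).L.o t) := by
  induction n generalizing ε with
  | zero =>
    obtain ⟨δ, hδ, hδ1, h⟩ := hT.apply_step hε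
    exact ⟨δ, hδ, hδ1, fun Wt s _ hk hreach => h (Wt 0) (s 0) (hk 0) hreach⟩
  | succ n ih =>
    obtain ⟨δ₁, hδ₁, hδ₁1, hlast⟩ := hT.apply_step hε
    obtain ⟨δ₀, hδ₀, hδ₀1, hfirst⟩ := ih hδ₁
    refine ⟨min δ₀ δ₁, lt_min hδ₀ hδ₁, (min_le_left _ _).trans hδ₀1, fun Wt s hlink hk hreach => ?_⟩
    set Wt' : Fin (n + 1) → Sym2 V → unitInterval := fun i => Wt (Fin.castSucc i) with hWt'
    set s' : Fin (n + 1) → TStep G := fun i => s (Fin.castSucc i) with hs'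
    have hlink' : ∀ i : Fin n, (prodBernoulli (Wt' (Fin.castSucc i))).real
        (⋃ t ∈ (s' (Fin.castSucc i)).T, openConn (s' (Fin.castSucc i)).L.o t) ≤
        (prodBernoulli (Wt' i.succ)).real (s' i.succ).L.reachB := fun i => by
      have := hlink (Fin.castSucc i)
      have e : (Fin.castSucc i).succ = Fin.castSucc i.succ := Fin.ext (by simp)
      rwa [e] at this
    have hk' : ∀ i : Fin (n + 1), (s' i).KitsAt (Wt' i) p Δ δ₀ := fun i => (hk (Fin.castSucc i)).mono (min_le_left _ _)
    have hreach' : 1 - δ₀ < (prodBernoulli (Wt' 0)).real (s' 0).L.reachB :=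
      lt_of_le_of_lt (by linarith [min_le_left δ₀ δ₁]) hreach
    have hmid := hfirst Wt' s' hlink' hk' hreach'
    have hreachLast : 1 - δ₁ < (prodBernoulli (Wt (Fin.last (n + 1)))).real (s (Fin.last (n + 1))).L.reachB := by
      have := hlink (Fin.last n)
      rw [Fin.succ_last] at this
      exact hmid.trans_le this
    exact hlast (Wt (Fin.last (n + 1))) (s (Fin.last (n + 1))) ((hk _).mono (min_le_right _ _)) hreachLast

/-! ## The restricted-weighting dictionary -/

omit [DecidableEq V] [G.LocallyFinite] in
/-- Under `W` restricted to `U ∋ o`, `{o ↔ X(0)}` has the `W`-probability of `{o ↔ X(0) inside U}`. [folklore] -/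
theorem real_restrW_reachB [Countable V] (W : Sym2 V → unitInterval) {U : Set V} (s : TStep G) (ho : s.L.o ∈ U) :
    (prodBernoulli (restrW U W)).real s.L.reachB = (prodBernoulli W).real (⋃ b ∈ s.L.X 0, openConnIn U s.L.o b) := by
  unfold LData.reachB
  rw [← Finset.set_biUnion_coe, prodBernoulli_restrW_real_biUnion_openConn W U ho, Finset.set_biUnion_coe]

omit [DecidableEq V] [G.LocallyFinite] in
/-- Under `W` restricted to `U ∋ o`, `{o ↔ T}` has the `W`-probability of `{o ↔ T inside U}`. [folklore] -/
theorem real_restrW_target [Countable V] (W : Sym2 V → unitInterval) {U : Set V} (s : TStep G) (ho : s.L.o ∈ U) :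
    (prodBernoulli (restrW U W)).real (⋃ t ∈ s.T, openConn s.L.o t) =
      (prodBernoulli W).real (⋃ t ∈ s.T, openConnIn U s.L.o t) := by
  rw [← Finset.set_biUnion_coe, prodBernoulli_restrW_real_biUnion_openConn W U ho, Finset.set_biUnion_coe]

omit [DecidableEq V] [G.LocallyFinite] in
/-- `{o ↔ T inside U}` is monotone in the region and in the (finite) target. [folklore] -/
theorem biUnion_openConnIn_mono_finset {U U' : Set V} (hU : U ⊆ U') (o : V) {T T' : Finset V} (hT : T ⊆ T') :
    (⋃ t ∈ T, openConnIn U o t : Set (BondConfig V)) ⊆ ⋃ t ∈ T', openConnIn U' o t := by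
  rw [← Finset.set_biUnion_coe, ← Finset.set_biUnion_coe]
  exact biUnion_openConnIn_mono hU o (Finset.coe_subset.2 hT)

/-! ## Corridor plans and the corridor lemma over levels -/

/-- **A corridor plan of length `n`**: restriction regions `U_0, …, U_n` and target steps `s_0, …, s_n` (the instance's rendering of KN's
`d` halving steps inside `A` followed by the corridor step inside `U`). [cite: KozmaNitzan2024, §4 Lemma 12 (pp. 23–25)] -/
structure CorridorPlan (G : SimpleGraph V) (n : ℕ) where
  /-- the restriction region of step `i` -/
  U : Fin (n + 1) → Set V
  /-- the target step `i` -/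
  s : Fin (n + 1) → TStep G

/-- **The plan runs at accuracy `δ`** from `B₀` inside `A` to `Mnext` inside `Ufin`, for the weighting `W` and source `o`: every step has source
`o ∈ U_i`; `A ⊆ U_0 ⊆ U_1 ⊆ ⋯ ⊆ U_n ⊆ Ufin`; `B₀ ⊆ X_0(0)`, `T_i ⊆ X_{i+1}(0)`, `T_n ⊆ Mnext`; and step `i` carries kits at accuracy `δ` under
the restricted weighting `restrW U_i W`. [cite: KozmaNitzan2024, §4 Lemma 12 (pp. 23–25)] -/
structure CorridorPlan.Runs {n : ℕ} (P : CorridorPlan G n) (W : Sym2 V → unitInterval) (p : unitInterval) (Δ : ℕ) (δ : ℝ)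
    (o : V) (A Ufin : Set V) (B₀ Mnext : Finset V) : Prop where
  src : ∀ i, (P.s i).L.o = o
  mem : ∀ i, o ∈ P.U i
  A_sub : A ⊆ P.U 0
  mono : ∀ i : Fin n, P.U (Fin.castSucc i) ⊆ P.U i.succ
  U_sub : P.U (Fin.last n) ⊆ Ufin
  start : B₀ ⊆ (P.s 0).L.X 0
  link : ∀ i : Fin n, (P.s (Fin.castSucc i)).T ⊆ (P.s i.succ).L.X 0
  finish : (P.s (Fin.last n)).T ⊆ Mnext
  kits : ∀ i, (P.s i).KitsAt (restrW (P.U i) W) p Δ δ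

/-- **Kozma–Nitzan's Lemma 12 over levels (corridor lemma from a plan).**  If the target property holds at `(G, Δ, p)`, then for every
`ε > 0` and `n` there is `δ ∈ (0, 1]` such that for every weighting `W`, source `o ∈ A` and corridor plan of length `n` running at accuracy `δ`
from `B₀` inside `A` to `Mnext` inside `Ufin`: `1 - δ < P_W(o ↔ B₀ inside A) ⟹ 1 - ε < P_W(o ↔ Mnext inside Ufin)`.
(KN: `P(o ↔^A [-3r,3r]^d) > 1 - δ ⟹ P(o ↔^U (20r,0,…,0) + [-3r,3r]^d) > 1 - ε`.) [cite: KozmaNitzan2024, §4 Lemma 12 (pp. 23–25)] -/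
theorem corridor_of_plan [Countable V] {Δ : ℕ} {p : unitInterval} (hT : TargetProperty G Δ p) (n : ℕ) {ε : ℝ} (hε : 0 < ε) :
    ∃ δ : ℝ, 0 < δ ∧ δ ≤ 1 ∧ ∀ (W : Sym2 V → unitInterval) (P : CorridorPlan G n) (o : V) (A Ufin : Set V) (B₀ Mnext : Finset V),
      P.Runs W p Δ δ o A Ufin B₀ Mnext →
      1 - δ < (prodBernoulli W).real (⋃ b ∈ B₀, openConnIn A o b) →
        1 - ε < (prodBernoulli W).real (⋃ t ∈ Mnext, openConnIn Ufin o t) := by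
  obtain ⟨δ, hδ, hδ1, hchain⟩ := hT.chainW n hε
  refine ⟨δ, hδ, hδ1, fun W P o A Ufin B₀ Mnext hP hB₀ => ?_⟩
  have hmem : ∀ i, (P.s i).L.o ∈ P.U i := fun i => by rw [hP.src i]; exact hP.mem i
  -- links
  have hlink : ∀ i : Fin n, (prodBernoulli (restrW (P.U (Fin.castSucc i)) W)).real
      (⋃ t ∈ (P.s (Fin.castSucc i)).T, openConn (P.s (Fin.castSucc i)).L.o t) ≤
      (prodBernoulli (restrW (P.U i.succ) W)).real (P.s i.succ).L.reachB := by
    intro i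
    rw [real_restrW_target W _ (hmem _), real_restrW_reachB W _ (hmem _), hP.src, hP.src]
    exact measureReal_mono (biUnion_openConnIn_mono_finset (hP.mono i) o (hP.link i)) (measure_ne_top _ _)
  -- start
  have hstart : 1 - δ < (prodBernoulli (restrW (P.U 0) W)).real (P.s 0).L.reachB := by
    rw [real_restrW_reachB W _ (hmem 0), hP.src]
    exact hB₀.trans_le (measureReal_mono (biUnion_openConnIn_mono_finset hP.A_sub o hP.start) (measure_ne_top _ _))
  have h := hchain (fun i => restrW (P.U i) W) P.s hlink hP.kits hstart
  -- finish
  rw [real_restrW_target W _ (hmem _), hP.src] at h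
  exact h.trans_le (measureReal_mono (biUnion_openConnIn_mono_finset hP.U_sub o hP.finish) (measure_ne_top _ _))

/-- **The one-region special case** (`n` steps all inside the same region `U ∋ o`, `A = U = Ufin`): the form of KN's Lemma 11 chains
(`levelChain`) and of the corridor step. [cite: KozmaNitzan2024, §4 Lemma 11 (p. 22)] -/
theorem chain_in_region [Countable V] {Δ : ℕ} {p : unitInterval} (hT : TargetProperty G Δ p) (n : ℕ) {ε : ℝ} (hε : 0 < ε) :
    ∃ δ : ℝ, 0 < δ ∧ δ ≤ 1 ∧ ∀ (W : Sym2 V → unitInterval) (U : Set V) (s : Fin (n + 1) → TStep G) (o : V) (B₀ Mnext : Finset V),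
      o ∈ U → (∀ i, (s i).L.o = o) → B₀ ⊆ (s 0).L.X 0 → (∀ i : Fin n, (s (Fin.castSucc i)).T ⊆ (s i.succ).L.X 0) →
      (s (Fin.last n)).T ⊆ Mnext → (∀ i, (s i).KitsAt (restrW U W) p Δ δ) →
      1 - δ < (prodBernoulli W).real (⋃ b ∈ B₀, openConnIn U o b) →
        1 - ε < (prodBernoulli W).real (⋃ t ∈ Mnext, openConnIn U o t) := by
  obtain ⟨δ, hδ, hδ1, h⟩ := corridor_of_plan hT n hε
  refine ⟨δ, hδ, hδ1, fun W U s o B₀ Mnext ho hsrc hstart hlink hfin hkits => ?_⟩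
  exact h W ⟨fun _ => U, s⟩ o U U B₀ Mnext
    { src := hsrc, mem := fun _ => ho, A_sub := subset_rfl, mono := fun _ => subset_rfl, U_sub := subset_rfl, start := hstart,
      link := hlink, finish := hfin, kits := hkits }

end KNLevels

end Transplant

end Summit.CriticalPhenomena.PercolationContinuityZ3.Theorems
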